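import Mathlib.Algebra.Order.BigOperators.Ring.Finset
import Mathlib.Analysis.SpecialFunctions.Pow.Real
import Mathlib.Data.Finset.Max
import HarnessLib

/-!
# Large transversals of a set system (Caro–Wei / Turán), for LEMMA JPD

For the junta-product decorrelation lemma (`AffBells23JuntaProduct`, `AffBells23.JuntaProductDecorrelation`) one needs, inside a
set `P` (the support of a character), a TRANSVERSAL `A ⊆ P` of a family of reading sets `S k` (`|S k ∩ A| ≤ 1` for all `k`) of size

  `|A| ≥ |P|² / (|P| + Σ_k |S k ∩ P|·(|S k ∩ P| − 1))`.

This is Turán's bound for the conflict graph on `P` (`p ∼ q` iff some `S k` contains both), proved here by the Caro–Wei greedy argument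
(`exists_indep_caroWei`: remove a vertex of minimum degree with its neighbourhood; `Σ_p 1/(deg p + 1) ≤ |A|`) and Sedrakyan's form of
Cauchy–Schwarz (`Finset.sq_sum_div_le_sum_sq_div`).  Generic in the index types; no cell objects.
-/

namespace Summit.QuantumAdvantage.AdviceFreeQNC0

open Finset

namespace AffBells23

variable {ι κ : Type*} [DecidableEq ι]

/-- `p` and `q` CONFLICT: some reading set of the family contains both (an `abbrev`, so that decidability is inferred). -/
abbrev Conflict (s : Finset κ) (S : κ → Finset ι) (p q : ι) : Prop := ∃ k ∈ s, p ∈ S k ∧ q ∈ S k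

omit [DecidableEq ι] in
/-- Conflict is symmetric. -/
theorem conflict_comm {s : Finset κ} {S : κ → Finset ι} {p q : ι} (h : Conflict s S p q) : Conflict s S q p := by
  obtain ⟨k, hk, hp, hq⟩ := h
  exact ⟨k, hk, hq, hp⟩

/-- The conflict degree of `p` inside `B`. -/
def cdeg (s : Finset κ) (S : κ → Finset ι) (B : Finset ι) (p : ι) : ℕ :=
  (B.filter fun q => q ≠ p ∧ Conflict s S p q).card

/-- `A` is conflict-free (an independent set of the conflict graph). -/
def ConflictFree (s : Finset κ) (S : κ → Finset ι) (A : Finset ι) : Prop :=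
  ∀ p ∈ A, ∀ q ∈ A, p ≠ q → ¬ Conflict s S p q

omit [DecidableEq ι] in
/-- A conflict-free set is a transversal: it meets every reading set at most once. -/
theorem card_inter_le_one_of_conflictFree {s : Finset κ} {S : κ → Finset ι} {A : Finset ι} [DecidableEq ι]
    (hA : ConflictFree s S A) {k : κ} (hk : k ∈ s) : (S k ∩ A).card ≤ 1 := by
  rw [Finset.card_le_one]
  intro p hp q hq
  by_contra hpq
  exact hA p (mem_inter.mp hp).2 q (mem_inter.mp hq).2 hpq ⟨k, hk, (mem_inter.mp hp).1, (mem_inter.mp hq).1⟩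

/-- The degree is monotone in the ambient set. -/
theorem cdeg_mono (s : Finset κ) (S : κ → Finset ι) {B B' : Finset ι} (h : B' ⊆ B) (p : ι) :
    cdeg s S B' p ≤ cdeg s S B p :=
  card_le_card (filter_subset_filter _ h)

/-- **Caro–Wei (greedy)**: every `B` contains a conflict-free `A` with `Σ_{p ∈ B} 1/(deg_B p + 1) ≤ |A|`. -/
theorem exists_indep_caroWei (s : Finset κ) (S : κ → Finset ι) (B : Finset ι) :
    ∃ A ⊆ B, ConflictFree s S A ∧ ∑ p ∈ B, (1 : ℝ) / (cdeg s S B p + 1) ≤ A.card := by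
  induction B using Finset.strongInduction with
  | H B ih =>
    rcases B.eq_empty_or_nonempty with hB | hB
    · exact ⟨∅, empty_subset _, fun p hp => absurd hp (by simp), by simp [hB]⟩
    · -- a vertex of minimum degree and its closed neighbourhood
      obtain ⟨p₀, hp₀, hmin⟩ := exists_min_image B (cdeg s S B) hB
      set Nb : Finset ι := B.filter fun q => q = p₀ ∨ Conflict s S p₀ q with hNb
      set B' : Finset ι := B.filter fun q => ¬ (q = p₀ ∨ Conflict s S p₀ q) with hB'
      have hB'sub : B' ⊆ B := filter_subset _ _
      have hB'ss : B' ⊂ B := by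
        refine Finset.ssubset_iff_subset_ne.mpr ⟨hB'sub, fun h => ?_⟩
        have : p₀ ∈ B' := h ▸ hp₀
        exact (mem_filter.mp this).2 (Or.inl rfl)
      obtain ⟨A', hA'sub, hA'free, hA'sum⟩ := ih B' hB'ss
      have hp₀A' : p₀ ∉ A' := fun h => (mem_filter.mp (hA'sub h)).2 (Or.inl rfl)
      refine ⟨insert p₀ A', ?_, ?_, ?_⟩
      · exact insert_subset hp₀ (hA'sub.trans hB'sub)
      · intro p hp q hq hpq hc
        rw [mem_insert] at hp hq
        rcases hp with rfl | hp <;> rcases hq with rfl | hq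
        · exact hpq rfl
        · exact (mem_filter.mp (hA'sub hq)).2 (Or.inr hc)
        · exact (mem_filter.mp (hA'sub hp)).2 (Or.inr (conflict_comm hc))
        · exact hA'free p hp q hq hpq hc
      · -- the sum splits along the closed neighbourhood
        have hsplit := (Finset.sum_filter_add_sum_filter_not B (fun q => q = p₀ ∨ Conflict s S p₀ q)
          (fun p => (1 : ℝ) / (cdeg s S B p + 1))).symm
        rw [hsplit, card_insert_of_notMem hp₀A', Nat.cast_add, Nat.cast_one, add_comm (A'.card : ℝ) 1]
        refine add_le_add ?_ ?_
        · -- closed neighbourhood: `|Nb| = deg p₀ + 1` terms, each `≤ 1/(deg p₀ + 1)`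
          have hcardN : (Nb.card : ℝ) = cdeg s S B p₀ + 1 := by
            have : Nb = insert p₀ (B.filter fun q => q ≠ p₀ ∧ Conflict s S p₀ q) := by
              ext q
              simp only [hNb, mem_filter, mem_insert]
              constructor
              · rintro ⟨hq, h | h⟩
                · exact Or.inl h
                · by_cases hqp : q = p₀
                  · exact Or.inl hqp
                  · exact Or.inr ⟨hq, hqp, h⟩
              · rintro (h | ⟨hq, _, h⟩)
                · subst h; exact ⟨hp₀, Or.inl rfl⟩
                · exact ⟨hq, Or.inr h⟩
            rw [this, card_insert_of_notMem (by simp)]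
            unfold cdeg
            push_cast
            ring
          have hd0 : (0 : ℝ) < cdeg s S B p₀ + 1 := by positivity
          calc ∑ p ∈ Nb, (1 : ℝ) / (cdeg s S B p + 1)
              ≤ ∑ _p ∈ Nb, (1 : ℝ) / (cdeg s S B p₀ + 1) := by
                refine sum_le_sum fun p hp => ?_
                have hle := hmin p (mem_filter.mp hp).1
                exact one_div_le_one_div_of_le hd0 (by exact_mod_cast Nat.add_le_add_right hle 1)
            _ = 1 := by
                rw [sum_const, nsmul_eq_mul, hcardN]
                field_simp
        · -- the rest: degrees only drop
          calc ∑ p ∈ B', (1 : ℝ) / (cdeg s S B p + 1)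
              ≤ ∑ p ∈ B', (1 : ℝ) / (cdeg s S B' p + 1) := by
                refine sum_le_sum fun p _ => ?_
                have hle := cdeg_mono s S hB'sub p
                exact one_div_le_one_div_of_le (by positivity) (by exact_mod_cast Nat.add_le_add_right hle 1)
            _ ≤ A'.card := hA'sum

/-- **Degree sum ≤ Σ_k |S k ∩ P|(|S k ∩ P| − 1)** (each conflict of `p` inside `P` is witnessed by a reading set through `p`). -/
theorem sum_cdeg_le (s : Finset κ) (S : κ → Finset ι) (P : Finset ι) :
    ∑ p ∈ P, cdeg s S P p ≤ ∑ k ∈ s, (S k ∩ P).card * ((S k ∩ P).card - 1) := by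
  classical
  -- pointwise: `deg p ≤ Σ_{k ∈ s, p ∈ S k} (|S k ∩ P| − 1)`
  have hpt : ∀ p ∈ P, cdeg s S P p ≤ ∑ k ∈ s.filter (fun k => p ∈ S k), ((S k ∩ P).card - 1) := by
    intro p hp
    unfold cdeg
    have hsub : (P.filter fun q => q ≠ p ∧ Conflict s S p q)
        ⊆ (s.filter fun k => p ∈ S k).biUnion fun k => (S k ∩ P).erase p := by
      intro q hq
      rw [mem_filter] at hq
      obtain ⟨hqP, hqp, k, hk, hpk, hqk⟩ := hq
      rw [mem_biUnion]
      exact ⟨k, mem_filter.mpr ⟨hk, hpk⟩, mem_erase.mpr ⟨hqp, mem_inter.mpr ⟨hqk, hqP⟩⟩⟩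
    refine (card_le_card hsub).trans (card_biUnion_le.trans (sum_le_sum fun k hk => ?_))
    rw [card_erase_of_mem (mem_inter.mpr ⟨(mem_filter.mp hk).2, hp⟩)]
  refine (sum_le_sum hpt).trans ?_
  -- exchange the sums
  rw [Finset.sum_comm' (t' := s) (s' := fun k => S k ∩ P)]
  · refine sum_le_sum fun k _ => ?_
    rw [sum_const, smul_eq_mul]
  · intro p k
    simp only [mem_filter, mem_inter]
    tauto

/-- **LARGE TRANSVERSALS (Turán / Caro–Wei)**: inside `P` there is a transversal `A` of the family `(S k)_{k ∈ s}` with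
`|P|² ≤ |A| · (|P| + Σ_{k ∈ s} |S k ∩ P|·(|S k ∩ P| − 1))`. -/
theorem exists_transversal (s : Finset κ) (S : κ → Finset ι) (P : Finset ι) :
    ∃ A ⊆ P, (∀ k ∈ s, (S k ∩ A).card ≤ 1) ∧
      ((P.card : ℝ)) ^ 2 ≤ (A.card : ℝ) * (P.card + ∑ k ∈ s, ((S k ∩ P).card : ℝ) * (((S k ∩ P).card : ℝ) - 1)) := by
  obtain ⟨A, hAP, hfree, hsum⟩ := exists_indep_caroWei s S P
  refine ⟨A, hAP, fun k hk => card_inter_le_one_of_conflictFree hfree hk, ?_⟩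
  -- Sedrakyan: |P|² / Σ (deg+1) ≤ Σ 1/(deg+1) ≤ |A|
  have hT := Finset.sq_sum_div_le_sum_sq_div P (fun _ => (1 : ℝ)) (g := fun p => (cdeg s S P p : ℝ) + 1)
    (fun p _ => by positivity)
  simp only [sum_const, nsmul_eq_mul, mul_one, one_pow] at hT
  have hD : ∑ p ∈ P, ((cdeg s S P p : ℝ) + 1)
      ≤ P.card + ∑ k ∈ s, ((S k ∩ P).card : ℝ) * (((S k ∩ P).card : ℝ) - 1) := by
    rw [sum_add_distrib, sum_const, nsmul_eq_mul, mul_one, add_comm]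
    refine add_le_add le_rfl ?_
    have h := sum_cdeg_le s S P
    have hcast : ((∑ p ∈ P, cdeg s S P p : ℕ) : ℝ) ≤ ((∑ k ∈ s, (S k ∩ P).card * ((S k ∩ P).card - 1) : ℕ) : ℝ) := by
      exact_mod_cast h
    push_cast at hcast
    refine le_trans hcast (le_of_eq (sum_congr rfl fun k _ => ?_))
    rcases Nat.eq_zero_or_pos (S k ∩ P).card with hz | hpos
    · simp [hz]
    · rw [Nat.cast_sub hpos]; push_cast; ring
  have hpos : (0 : ℝ) < ∑ p ∈ P, ((cdeg s S P p : ℝ) + 1) ∨ P = ∅ := by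
    rcases P.eq_empty_or_nonempty with h | h
    · exact Or.inr h
    · exact Or.inl (sum_pos (fun p _ => by positivity) h)
  rcases hpos with hpos | hP
  · calc ((P.card : ℝ)) ^ 2 = ((P.card : ℝ)) ^ 2 / (∑ p ∈ P, ((cdeg s S P p : ℝ) + 1)) * (∑ p ∈ P, ((cdeg s S P p : ℝ) + 1)) := by
          field_simp
      _ ≤ (A.card : ℝ) * (∑ p ∈ P, ((cdeg s S P p : ℝ) + 1)) :=
          mul_le_mul_of_nonneg_right (hT.trans hsum) hpos.le
      _ ≤ _ := mul_le_mul_of_nonneg_left hD (by positivity)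
  · subst hP; simp

/-- The same with any upper bound `Λ₂ ≥ Σ_{k ∈ s} |S k|(|S k| − 1)` and `|P| ≥ w ≥ 0`: `w² / (w + Λ₂) ≤ |A|`. -/
theorem exists_transversal_ge (s : Finset κ) (S : κ → Finset ι) (P : Finset ι) {w Λ₂ : ℝ} (hw : 0 ≤ w)
    (hwP : w ≤ P.card) (hΛ : (∑ k ∈ s, ((S k).card : ℝ) * (((S k).card : ℝ) - 1)) ≤ Λ₂) :
    ∃ A ⊆ P, (∀ k ∈ s, (S k ∩ A).card ≤ 1) ∧ w ^ 2 / (w + Λ₂) ≤ (A.card : ℝ) := by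
  obtain ⟨A, hAP, htr, hsq⟩ := exists_transversal s S P
  refine ⟨A, hAP, htr, ?_⟩
  -- `Σ |S k ∩ P|(|S k ∩ P|−1) ≤ Λ₂`
  -- `a(a−1)` is monotone and non-negative on `ℕ` (the tree's `LubyRackoff.cast_mul_pred_le`, inlined to keep imports light)
  have hpair : ∀ {a b : ℕ}, a ≤ b → (a : ℝ) * ((a : ℝ) - 1) ≤ (b : ℝ) * ((b : ℝ) - 1) := by
    intro a b h
    rcases h.eq_or_lt with rfl | hlt
    · exact le_rfl
    · have h1 : (a : ℝ) + 1 ≤ b := by exact_mod_cast hlt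
      nlinarith [mul_nonneg (sub_nonneg.2 h1) (by positivity : (0 : ℝ) ≤ (b : ℝ) + a),
        (Nat.cast_nonneg a : (0 : ℝ) ≤ a)]
  have hpair0 : ∀ a : ℕ, 0 ≤ (a : ℝ) * ((a : ℝ) - 1) := fun a => by simpa using hpair (Nat.zero_le a)
  set D : ℝ := ∑ k ∈ s, ((S k ∩ P).card : ℝ) * (((S k ∩ P).card : ℝ) - 1) with hDdef
  have hmono : D ≤ Λ₂ :=
    le_trans (sum_le_sum fun k _ => hpair (card_le_card inter_subset_left)) hΛ
  have hD0 : 0 ≤ D := sum_nonneg fun k _ => hpair0 _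
  have hΛ0 : 0 ≤ Λ₂ := hD0.trans hmono
  rcases eq_or_lt_of_le hw with hw0 | hwpos
  · rw [← hw0]; simp
  · rw [div_le_iff₀ (by linarith)]
    have hP0 : (0 : ℝ) < P.card := lt_of_lt_of_le hwpos hwP
    have hden : (0 : ℝ) < (P.card : ℝ) + D := by linarith
    -- `w² (|P| + D) ≤ |P|² (w + Λ₂) ≤ |A| (|P| + D) (w + Λ₂)`
    have key : w ^ 2 * ((P.card : ℝ) + D) ≤ (P.card : ℝ) ^ 2 * (w + Λ₂) := by
      have h1 : w ^ 2 * (P.card : ℝ) ≤ (P.card : ℝ) ^ 2 * w := by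
        have := mul_le_mul_of_nonneg_left hwP (mul_nonneg hw hP0.le)
        nlinarith [this]
      have hw2 : w ^ 2 ≤ (P.card : ℝ) ^ 2 := pow_le_pow_left₀ hw hwP 2
      have h2 : w ^ 2 * D ≤ (P.card : ℝ) ^ 2 * Λ₂ :=
        calc w ^ 2 * D ≤ (P.card : ℝ) ^ 2 * D := mul_le_mul_of_nonneg_right hw2 hD0
          _ ≤ (P.card : ℝ) ^ 2 * Λ₂ := mul_le_mul_of_nonneg_left hmono (by positivity)
      nlinarith [h1, h2]
    have h3 : w ^ 2 * ((P.card : ℝ) + D) ≤ ((A.card : ℝ) * (w + Λ₂)) * ((P.card : ℝ) + D) :=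
      calc w ^ 2 * ((P.card : ℝ) + D) ≤ (P.card : ℝ) ^ 2 * (w + Λ₂) := key
        _ ≤ ((A.card : ℝ) * ((P.card : ℝ) + D)) * (w + Λ₂) :=
            mul_le_mul_of_nonneg_right hsq (by linarith)
        _ = ((A.card : ℝ) * (w + Λ₂)) * ((P.card : ℝ) + D) := by ring
    exact le_of_mul_le_mul_right h3 hden

end AffBells23

end Summit.QuantumAdvantage.AdviceFreeQNC0
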